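import Mathlib.Algebra.Order.BigOperators.Group.Finset
import Mathlib.Algebra.BigOperators.Ring.Finset
import Mathlib.Algebra.Order.Archimedean.Real.Basic
import Mathlib.Order.ConditionallyCompleteLattice.Basic
import Mathlib.Tactic.Linarith
import Mathlib.Tactic.Ring
import HarnessLib

/-!
# Weak duality and the Lagrangian (dual-decomposition) split bound — Bertsekas, *Nonlinear Programming*

Topic `Literature/Computation/Certificates` (joins `SemidefiniteRigorousBounds.lean`,
`LinearProgramming.lean`: kernel-checkable certificate arithmetic). Source: D. P. Bertsekas,
*Nonlinear Programming*, 2nd ed., Athena Scientific 1999 [Bertsekas1999NonlinearProgramming]: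

* **Proposition 5.1.3 (Weak Duality Theorem)**, p. 487: with `q(μ) = inf_{x ∈ X} L(x, μ)`,
  `L(x, μ) = f(x) + Σ_j μ_j g_j(x)`, one has `q* ≤ f*`; the printed proof is the pointwise statement
  "for all `μ ≥ 0` and `x ∈ X` with `g(x) ≤ 0`, `q(μ) ≤ f(x) + Σ_j μ_j g_j(x) ≤ f(x)`";
* **§5.1.5 (Treatment of Equality Constraints)**, p. 493: equality constraints `h_i(x) = 0` enter the
  Lagrangian as `Σ_i λ_i h_i(x)` with `λ ∈ ℝ^m` of unrestricted sign, and "Props. 5.1.1 through 5.1.6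
  have analogs where the sign of `λ_i` is unrestricted";
* **§5.1.6 (Separable Problems and their Geometry)**, p. 494: for `minimize Σ_i f_i(x_i)` subject to
  `Σ_i g_ij(x_i) ≤ 0`, `x_i ∈ X_i`, the dual function DECOMPOSES, `q(μ) = Σ_i q_i(μ)` with
  `q_i(μ) = inf_{x_i ∈ X_i} { f_i(x_i) + Σ_j μ_j g_ij(x_i) }`.

What is proved (everything over `ℝ`, finite index types, no topology):

* `Bertsekas.dualValue_le_of_feasible` — Prop. 5.1.3 with §5.1.5's equality multipliers, in the
  pointwise form of the printed proof: if `q` is a lower bound of the Lagrangian on `X`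
  (`q ≤ L(z, μ, λ)` for all `z ∈ X`, which is what "`q ≤ q(μ, λ)`" means), `μ ≥ 0`, and `x ∈ X` is
  feasible (`g(x) ≤ 0`, `h(x) = 0`), then `q ≤ f(x)`; `Bertsekas.dualValue_le_sInf` — hence
  `q ≤ f* = inf f` over the feasible set;
* `Bertsekas.splitBound_le` — the two-block separable case (§5.1.6 with `m = 2`) written for
  the programme's LINEAR objective / linear COUPLING rows (the "Lagrangian split" of a hybrid conic
  program `P`: variables `y_c ∈ K_c` (core), `y_w ∈ K_w` (window), objective `c_c·y_c + c_w·y_w + c₀`,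
  coupling equalities `L_c y_c + L_w y_w = b`): for EVERY `β` (sign unrestricted) and any numbers
  `ℓ_c ≤ inf_{K_c} ((c_c − L_cᵀβ)·y_c + c₀)`, `ℓ_w ≤ inf_{K_w} (c_w − L_wᵀβ)·y_w` (given pointwise),
  every feasible `(y_c, y_w)` has objective `≥ ℓ_c + ℓ_w + βᵀb`; `Bertsekas.splitBound_le_of_couplingLE`
  — the same with coupling INEQUALITIES `L_c y_c + L_w y_w ≤ b` and then `β ≤ 0` (this file's shift
  convention `c − Lᵀβ`, `+βᵀb` is Bertsekas's `λ = −β`, so his `μ ≥ 0` reads `β ≤ 0` here);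
  `Bertsekas.splitBound_le_sInf` — the consequence for the optimal value.

The sets `K_c`, `K_w`, `X` are arbitrary (`Set _`): PSD-cone membership, further rows, a-priori
bounds — whatever the sub-certificates assume — live inside them; the sub-bounds `ℓ_c`, `ℓ_w` are
hypotheses (in the fleet they come from `JanssonChaykinKeil.lmiForm_bound` or an exact dual).
No definitions, no named facts; everything is proved. Deliberately NOT here: existence of optimal
multipliers / zero duality gap (Props. 5.1.4–5.1.5, convexity), which certificates never need.
-/

namespace Literature.Computation.Certificates

open Finset

namespace Bertsekas

/-! ## Prop. 5.1.3 + §5.1.5: weak duality, pointwise -/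

section WeakDuality

variable {X : Type*} {r m : Type*} [Fintype r] [Fintype m]

/-- **Weak duality, pointwise (Bertsekas, Prop. 5.1.3 with the equality multipliers of §5.1.5).**
With `L(z, μ, λ) = f z + Σ_j μ_j g_j z + Σ_i λ_i h_i z`: if `q ≤ L(z, μ, λ)` for every `z ∈ S`
(i.e. `q` is below the dual function value `q(μ, λ) = inf_{z ∈ S} L`), `μ ≥ 0`, and `x ∈ S` satisfies
`g_j x ≤ 0`, `h_i x = 0`, then `q ≤ f x`. This is the printed chain
`q(μ) ≤ f(x) + Σ μ_j g_j(x) ≤ f(x)`. [cite: Bertsekas1999NonlinearProgramming, Prop. 5.1.3 and §5.1.5] -/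
theorem dualValue_le_of_feasible (S : Set X) (f : X → ℝ) (g : r → X → ℝ) (h : m → X → ℝ)
    (μ : r → ℝ) (lam : m → ℝ) (hμ : ∀ j, 0 ≤ μ j) {q : ℝ}
    (hq : ∀ z ∈ S, q ≤ f z + ∑ j, μ j * g j z + ∑ i, lam i * h i z)
    {x : X} (hx : x ∈ S) (hg : ∀ j, g j x ≤ 0) (hh : ∀ i, h i x = 0) : q ≤ f x := by
  have h1 := hq x hx
  have h2 : ∑ j, μ j * g j x ≤ 0 :=
    Finset.sum_nonpos fun j _ => mul_nonpos_of_nonneg_of_nonpos (hμ j) (hg j)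
  have h3 : ∑ i, lam i * h i x = 0 := Finset.sum_eq_zero fun i _ => by rw [hh i, mul_zero]
  linarith

/-- **Weak duality for the optimal value (Bertsekas, Prop. 5.1.3: `q* ≤ f*`, one multiplier at a
time).** Under the hypotheses of `dualValue_le_of_feasible`, `q ≤ inf { f x : x feasible }` whenever
the feasible set is nonempty. [cite: Bertsekas1999NonlinearProgramming, Prop. 5.1.3 and §5.1.5] -/
theorem dualValue_le_sInf (S : Set X) (f : X → ℝ) (g : r → X → ℝ) (h : m → X → ℝ)
    (μ : r → ℝ) (lam : m → ℝ) (hμ : ∀ j, 0 ≤ μ j) {q : ℝ}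
    (hq : ∀ z ∈ S, q ≤ f z + ∑ j, μ j * g j z + ∑ i, lam i * h i z)
    (hne : ∃ x ∈ S, (∀ j, g j x ≤ 0) ∧ ∀ i, h i x = 0) :
    q ≤ sInf (f '' {x | x ∈ S ∧ (∀ j, g j x ≤ 0) ∧ ∀ i, h i x = 0}) := by
  obtain ⟨x0, hx0, hg0, hh0⟩ := hne
  apply le_csInf
  · exact ⟨f x0, ⟨x0, ⟨hx0, hg0, hh0⟩, rfl⟩⟩
  · rintro _ ⟨x, ⟨hx, hg, hh⟩, rfl⟩
    exact dualValue_le_of_feasible S f g h μ lam hμ hq hx hg hh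

end WeakDuality

/-! ## §5.1.6 with two blocks: the Lagrangian split bound for linear objective / linear couplings -/

section Split

variable {Vc Vw Q : Type*} [Fintype Vc] [Fintype Vw] [Fintype Q]

/-- The algebra of the split (private helper): for any vectors, the objective plus
`βᵀ(b − L_c y_c − L_w y_w)` equals the sum of the two β-SHIFTED block objectives plus `βᵀb` — the
identity behind §5.1.6's `q(μ) = Σ_i q_i(μ)`. [folklore] -/
private theorem split_identity (cc : Vc → ℝ) (cw : Vw → ℝ) (c0 : ℝ)
    (Lc : Q → Vc → ℝ) (Lw : Q → Vw → ℝ) (b : Q → ℝ) (β : Q → ℝ)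
    (yc : Vc → ℝ) (yw : Vw → ℝ) :
    (∑ v, cc v * yc v + ∑ v, cw v * yw v + c0)
        + ∑ j, β j * (b j - (∑ v, Lc j v * yc v + ∑ v, Lw j v * yw v))
      = (∑ v, (cc v - ∑ j, β j * Lc j v) * yc v + c0)
        + (∑ v, (cw v - ∑ j, β j * Lw j v) * yw v) + ∑ j, β j * b j := by
  have hc : ∑ v, (cc v - ∑ j, β j * Lc j v) * yc v
      = ∑ v, cc v * yc v - ∑ j, β j * ∑ v, Lc j v * yc v := by
    simp only [sub_mul, Finset.sum_sub_distrib, Finset.sum_mul, Finset.mul_sum]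
    rw [Finset.sum_comm]
    simp only [mul_assoc]
  have hw : ∑ v, (cw v - ∑ j, β j * Lw j v) * yw v
      = ∑ v, cw v * yw v - ∑ j, β j * ∑ v, Lw j v * yw v := by
    simp only [sub_mul, Finset.sum_sub_distrib, Finset.sum_mul, Finset.mul_sum]
    rw [Finset.sum_comm]
    simp only [mul_assoc]
  have hb : ∑ j, β j * (b j - (∑ v, Lc j v * yc v + ∑ v, Lw j v * yw v))
      = ∑ j, β j * b j - ∑ j, β j * ∑ v, Lc j v * yc v - ∑ j, β j * ∑ v, Lw j v * yw v := by
    simp only [mul_sub, mul_add, Finset.sum_sub_distrib, Finset.sum_add_distrib]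
    ring
  rw [hc, hw, hb]
  ring

/-- **Lagrangian split (dual-decomposition) bound, equality couplings (Bertsekas §5.1.6 with
`m = 2`, multipliers of unrestricted sign per §5.1.5).** Program `P`: minimise
`c_c·y_c + c_w·y_w + c₀` over `y_c ∈ K_c`, `y_w ∈ K_w`, subject to the coupling rows
`Σ_v L_c[j,v] y_c[v] + Σ_v L_w[j,v] y_w[v] = b_j`. For EVERY `β : Q → ℝ`: if `ℓ_c` is a lower bound of
the β-shifted core objective `(c_c − L_cᵀβ)·y_c + c₀` on `K_c` and `ℓ_w` a lower bound of
`(c_w − L_wᵀβ)·y_w` on `K_w` (each may come from any certificate valid for that sub-program), then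
every feasible point of `P` has objective `≥ ℓ_c + ℓ_w + βᵀb` — the printed `q(μ) = Σ_i q_i(μ) ≤ f*`.
The same exact `β` must enter all three terms. [cite: Bertsekas1999NonlinearProgramming, §5.1.6 and Prop. 5.1.3] -/
theorem splitBound_le (Kc : Set (Vc → ℝ)) (Kw : Set (Vw → ℝ))
    (cc : Vc → ℝ) (cw : Vw → ℝ) (c0 : ℝ)
    (Lc : Q → Vc → ℝ) (Lw : Q → Vw → ℝ) (b : Q → ℝ) (β : Q → ℝ) {ℓc ℓw : ℝ}
    (hc : ∀ yc ∈ Kc, ℓc ≤ ∑ v, (cc v - ∑ j, β j * Lc j v) * yc v + c0)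
    (hw : ∀ yw ∈ Kw, ℓw ≤ ∑ v, (cw v - ∑ j, β j * Lw j v) * yw v)
    {yc : Vc → ℝ} {yw : Vw → ℝ} (hyc : yc ∈ Kc) (hyw : yw ∈ Kw)
    (hlink : ∀ j, ∑ v, Lc j v * yc v + ∑ v, Lw j v * yw v = b j) :
    ℓc + ℓw + ∑ j, β j * b j ≤ ∑ v, cc v * yc v + ∑ v, cw v * yw v + c0 := by
  have hid := split_identity cc cw c0 Lc Lw b β yc yw
  have hz : ∑ j, β j * (b j - (∑ v, Lc j v * yc v + ∑ v, Lw j v * yw v)) = 0 :=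
    Finset.sum_eq_zero fun j _ => by rw [hlink j, sub_self, mul_zero]
  have h1 := hc yc hyc
  have h2 := hw yw hyw
  linarith

/-- **Lagrangian split bound, inequality couplings.** As `splitBound_le` but with coupling rows
`Σ_v L_c[j,v] y_c[v] + Σ_v L_w[j,v] y_w[v] ≤ b_j`; then the multiplier must satisfy `β_j ≤ 0` in this
file's shift convention (`c − Lᵀβ`, `+ βᵀb`), which is Bertsekas's `μ = −β ≥ 0` of Prop. 5.1.3.
[cite: Bertsekas1999NonlinearProgramming, §5.1.6 and Prop. 5.1.3] -/
theorem splitBound_le_of_couplingLE (Kc : Set (Vc → ℝ)) (Kw : Set (Vw → ℝ))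
    (cc : Vc → ℝ) (cw : Vw → ℝ) (c0 : ℝ)
    (Lc : Q → Vc → ℝ) (Lw : Q → Vw → ℝ) (b : Q → ℝ) (β : Q → ℝ) (hβ : ∀ j, β j ≤ 0) {ℓc ℓw : ℝ}
    (hc : ∀ yc ∈ Kc, ℓc ≤ ∑ v, (cc v - ∑ j, β j * Lc j v) * yc v + c0)
    (hw : ∀ yw ∈ Kw, ℓw ≤ ∑ v, (cw v - ∑ j, β j * Lw j v) * yw v)
    {yc : Vc → ℝ} {yw : Vw → ℝ} (hyc : yc ∈ Kc) (hyw : yw ∈ Kw)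
    (hlink : ∀ j, ∑ v, Lc j v * yc v + ∑ v, Lw j v * yw v ≤ b j) :
    ℓc + ℓw + ∑ j, β j * b j ≤ ∑ v, cc v * yc v + ∑ v, cw v * yw v + c0 := by
  have hid := split_identity cc cw c0 Lc Lw b β yc yw
  have hz : ∑ j, β j * (b j - (∑ v, Lc j v * yc v + ∑ v, Lw j v * yw v)) ≤ 0 :=
    Finset.sum_nonpos fun j _ =>
      mul_nonpos_of_nonpos_of_nonneg (hβ j) (sub_nonneg.mpr (hlink j))
  have h1 := hc yc hyc
  have h2 := hw yw hyw
  linarith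

/-- **The split bound for the optimal value**: under the hypotheses of `splitBound_le`,
`ℓ_c + ℓ_w + βᵀb ≤ p*(P) := inf` of the objective over the feasible set of `P` (nonempty).
[cite: Bertsekas1999NonlinearProgramming, §5.1.6 and Prop. 5.1.3] -/
theorem splitBound_le_sInf (Kc : Set (Vc → ℝ)) (Kw : Set (Vw → ℝ))
    (cc : Vc → ℝ) (cw : Vw → ℝ) (c0 : ℝ)
    (Lc : Q → Vc → ℝ) (Lw : Q → Vw → ℝ) (b : Q → ℝ) (β : Q → ℝ) {ℓc ℓw : ℝ}
    (hc : ∀ yc ∈ Kc, ℓc ≤ ∑ v, (cc v - ∑ j, β j * Lc j v) * yc v + c0)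
    (hw : ∀ yw ∈ Kw, ℓw ≤ ∑ v, (cw v - ∑ j, β j * Lw j v) * yw v)
    (hne : ∃ yc ∈ Kc, ∃ yw ∈ Kw, ∀ j, ∑ v, Lc j v * yc v + ∑ v, Lw j v * yw v = b j) :
    ℓc + ℓw + ∑ j, β j * b j ≤
      sInf ((fun p : (Vc → ℝ) × (Vw → ℝ) => ∑ v, cc v * p.1 v + ∑ v, cw v * p.2 v + c0) ''
        {p | p.1 ∈ Kc ∧ p.2 ∈ Kw ∧ ∀ j, ∑ v, Lc j v * p.1 v + ∑ v, Lw j v * p.2 v = b j}) := by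
  obtain ⟨yc0, hyc0, yw0, hyw0, hl0⟩ := hne
  apply le_csInf
  · exact ⟨_, ⟨(yc0, yw0), ⟨hyc0, hyw0, hl0⟩, rfl⟩⟩
  · rintro _ ⟨p, ⟨hpc, hpw, hpl⟩, rfl⟩
    exact splitBound_le Kc Kw cc cw c0 Lc Lw b β hc hw hpc hpw hpl

end Split

end Bertsekas

end Literature.Computation.Certificates
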